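import Summits.AnomalousDissipation.AnomalousDissipation.Theorems.ImpulseGridGridSignsCoherentTransfer
import Literature.Analysis.FunctionSpaces.TorusFourierCalculus

/-!
# Route ImpulseGrid (AnomalousDissipation) — coherent wakes with a detuned-work floor give `GridThesis`

Registered sub-goal `gridThesis_of_detunedCoherentWakes` of the crux `GridSigns`
(stmt-AnomalousDissipation-1771), line `Sketch`: the viscosity-free LINEAR coherent-wake hypothesis — a
slab⊗transverse design and a vanishing-viscosity family of time-periodic classical wakes with drift
`c`, energy `∫‖u j t‖² ≤ E` uniformly in `j, t`, nonnegative period-mean resonant work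
`∫₀^τ (G,u j) ≥ 0` and a detuned-work floor `c·∫₀^τ((Φ−1)G,u j) ≥ τ·η` (the hypothesis of the landed
`gridSigns_of_detunedCoherentWakes`, `Theorems/ImpulseGridGridSignsDetunedTransfer.lean`) — gives the
route TARGET `GridThesis` (stmt-AnomalousDissipation-1770) with `η/2` after a tail shift `j ↦ j + J`
(the `O(ν)` term `ν∫₀^τ(u,Δ(Ψ•G))` is bounded by `τ·ν·‖Δ(Ψ•G)‖_∞(1+E)/2`,
`impulseGrid_abs_integral_inner_le`); no leakage holds with EQUALITY along a periodic classical wake.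

This module imports only `ImpulseGridGridSignsCoherentTransfer`; its private helpers restate, for
self-containedness, the period bookkeeping lemmas of the companion files
`ImpulseGridGridThesisCoherentTransfer` / `ImpulseGridGridSignsDetunedTransfer` (spectral = classical
dissipation on smooth slices, `Torus.eGradNormSq_eq_ofReal_gradNormSq`; no leakage with equality;
detuned work = dissipation minus resonant work by the period energy balance). No new definitions.
-/

noncomputable section

-- `Summit.<Summit>.<Problem>` is the tree's mandated summit-side namespace (CONVENTIONS §2); for this
-- single-conjunct summit the two coincide, so the duplicate is deliberate.
set_option linter.dupNamespace false

open MeasureTheory Set Filter Topology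
open scoped InnerProductSpace RealInnerProductSpace

namespace Summit.AnomalousDissipation.AnomalousDissipation.Theorems.ImpulseGridGridSigns

open Literature.Analysis
open Literature.Analysis.FluidPDE
open Literature.Analysis.FunctionSpaces Literature.Analysis.FunctionSpaces.Torus
open Summit.AnomalousDissipation.AnomalousDissipation.Theses.ImpulseGrid

section Transfer

variable {Φ Ψ : UnitAddTorus (Fin 3) → ℝ} {G : UnitAddTorus (Fin 3) → EuclideanSpace ℝ (Fin 3)}
  {ν τ : ℝ} {u : ℝ → UnitAddTorus (Fin 3) → EuclideanSpace ℝ (Fin 3)}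
  {p : ℝ → UnitAddTorus (Fin 3) → ℝ}

/-- Along a classical solution on all of `ℝ` the spectral dissipation integrand of
`meanDissipation` is the classical one (`Torus.eGradNormSq_eq_ofReal_gradNormSq` slice-wise). [folklore] -/
private theorem dissipationIntegrand_eq_aux
    (h : FunctionSpaces.Torus.IsClassicalNSSolutionOn Set.univ ν (fun _ => fun x => Φ x • G x) u p) :
    (fun t => ν * (eGradNormSq (u t)).toReal) = fun t => ν * gradNormSq (u t) := by
  funext t
  rw [eGradNormSq_eq_ofReal_gradNormSq (h.smooth_velocity.isSmooth_slice (mem_univ t)),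
    ENNReal.toReal_ofReal (gradNormSq_nonneg _)]

/-- Mean dissipation of a periodic classical wake is the period mean of `ν‖∇u‖₂²`. [folklore] -/
private theorem meanDissipation_eq_aux
    (h : FunctionSpaces.Torus.IsClassicalNSSolutionOn Set.univ ν (fun _ => fun x => Φ x • G x) u p)
    (hper : Function.Periodic u τ) (hτ : 0 < τ) :
    meanDissipation ν u = τ⁻¹ * (ν * ∫ t in (0 : ℝ)..τ, gradNormSq (u t)) := by
  rw [meanDissipation, dissipationIntegrand_eq_aux h,
    longTimeAvgSup_eq_of_periodic (periodic_comp hper fun v => ν * gradNormSq v) hτ,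
    intervalIntegral.integral_const_mul]

/-- No leakage along a periodic classical wake, with equality:
`longTimeAvgSup (Φ•G,u) = meanDissipation ν u`. [folklore] -/
private theorem work_eq_meanDissipation_aux
    (h : FunctionSpaces.Torus.IsClassicalNSSolutionOn Set.univ ν (fun _ => fun x => Φ x • G x) u p)
    (hper : Function.Periodic u τ) (hτ : 0 < τ) :
    longTimeAvgSup (fun t => ∫ x, ⟪Φ x • G x, u t x⟫) = meanDissipation ν u := by
  rw [meanDissipation_eq_aux h hper hτ,
    longTimeAvgSup_eq_of_periodic (periodic_comp hper fun v => ∫ x, ⟪Φ x • G x, v x⟫) hτ,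
    period_work_eq_dissipation h hper hτ]

/-- **Period detuned work = dissipation minus resonant work** along a periodic classical wake:
`∫₀^τ ∫(Φ−1)⟪G,u⟫ = ν∫₀^τ‖∇u‖₂² − ∫₀^τ (G,u)` (slice-wise `∫(Φ−1)⟪G,u⟫ = ∫⟪Φ•G,u⟫ − ∫⟪G,u⟫` and the
period energy balance `period_work_eq_dissipation`). [folklore] -/
private theorem detunedWork_eq_aux
    (h : FunctionSpaces.Torus.IsClassicalNSSolutionOn Set.univ ν (fun _ => fun x => Φ x • G x) u p)
    (hΦ : IsSmooth Φ) (hG : IsSmooth G) (hper : Function.Periodic u τ) (hτ : 0 < τ) :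
    ∫ t in (0 : ℝ)..τ, ∫ x, (Φ x - 1) * ⟪G x, u t x⟫ =
      ν * (∫ t in (0 : ℝ)..τ, gradNormSq (u t)) - ∫ t in (0 : ℝ)..τ, ∫ x, ⟪G x, u t x⟫ := by
  have hslice : ∀ t, ∫ x, (Φ x - 1) * ⟪G x, u t x⟫ = (∫ x, ⟪Φ x • G x, u t x⟫) - ∫ x, ⟪G x, u t x⟫ := by
    intro t
    have hu : IsSmooth (u t) := h.smooth_velocity.isSmooth_slice (mem_univ t)
    have iF : Integrable (fun x => ⟪Φ x • G x, u t x⟫) volume :=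
      ((hΦ.smul' hG).continuous.inner hu.continuous).integrable_of_hasCompactSupport
        (HasCompactSupport.of_compactSpace _)
    have iG : Integrable (fun x => ⟪G x, u t x⟫) volume :=
      (hG.continuous.inner hu.continuous).integrable_of_hasCompactSupport
        (HasCompactSupport.of_compactSpace _)
    rw [← integral_sub iF iG]
    refine integral_congr_ae (ae_of_all _ fun x => ?_)
    dsimp only
    rw [real_inner_smul_left]
    ring
  simp_rw [hslice]
  have cF : IntervalIntegrable (fun t => ∫ x, ⟪Φ x • G x, u t x⟫) volume 0 τ :=
    (continuous_integral_inner_const h (hΦ.smul' hG)).continuousOn.intervalIntegrable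
  have cG : IntervalIntegrable (fun t => ∫ x, ⟪G x, u t x⟫) volume 0 τ :=
    (continuous_integral_inner_const h hG).continuousOn.intervalIntegrable
  rw [intervalIntegral.integral_sub cF cG, period_work_eq_dissipation h hper hτ]

/-- **Coherent wakes with a detuned-work floor give the target `GridThesis`** (with `η/2` and the
tail of the family): as `gridSigns_of_detunedCoherentWakes`, plus the per-`j` sup-in-time energy bound
(pointwise from the uniform `L²` bound) and no leakage (equality along a periodic classical wake,
`longTimeAvgSup_work_eq_meanDissipation`). [folklore] -/
theorem gridThesis_of_detunedCoherentWakes :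
    (∃ (Φ Ψ : UnitAddTorus (Fin 3) → ℝ) (G : UnitAddTorus (Fin 3) → EuclideanSpace ℝ (Fin 3)) (c η : ℝ),
      IsSmooth Φ ∧ IsSmooth Ψ ∧ IsSmooth G ∧
      (∀ (s : UnitAddCircle) x, Ψ (x + Pi.single (1 : Fin 3) s) = Ψ x ∧ Ψ (x + Pi.single (2 : Fin 3) s) = Ψ x) ∧
      (∀ (s : UnitAddCircle) x, G (x + Pi.single (0 : Fin 3) s) = G x) ∧ (∀ x, G x 0 = 0) ∧ IsDivFree G ∧
      (∀ x, Torus.partialDeriv 0 Ψ x = Φ x - 1) ∧ (∫ x, Φ x * Ψ x * ‖G x‖ ^ 2 = 0) ∧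
      IsSmooth (fun x => Φ x • G x) ∧ IsDivFree (fun x => Φ x • G x) ∧ HasZeroMean (fun x => Φ x • G x) ∧
      0 < c ∧ 0 < η ∧
      ∃ (ν τ : ℕ → ℝ) (u : ℕ → ℝ → UnitAddTorus (Fin 3) → EuclideanSpace ℝ (Fin 3))
        (p : ℕ → ℝ → UnitAddTorus (Fin 3) → ℝ),
        (∀ j, 0 < ν j) ∧ Tendsto ν atTop (nhds 0) ∧
        (∀ j, FunctionSpaces.Torus.IsClassicalNSSolutionOn Set.univ (ν j) (fun _ => fun x => Φ x • G x) (u j) (p j) ∧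
          0 < τ j ∧ Function.Periodic (u j) (τ j)) ∧
        (∀ j, ∫ x, u j 0 x = c • EuclideanSpace.single 0 1) ∧
        (∃ E : ℝ, ∀ j t, ∫ x, ‖u j t x‖ ^ 2 ≤ E) ∧
        (∀ j, 0 ≤ ∫ t in (0 : ℝ)..τ j, ∫ x, ⟪G x, u j t x⟫) ∧
        (∀ j, τ j * η ≤ c * ∫ t in (0 : ℝ)..τ j, ∫ x, (Φ x - 1) * ⟪G x, u j t x⟫)) →
    GridThesis := by
  intro hC
  obtain ⟨Φ, Ψ, G, c, η, hΦ, hΨ, hG, hΨinv, hGinv, hG0, hGdiv, hΨ', hnorm, hf1, hf2, hf3, hc, hη,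
    ν, τ, u, p, hν, hν0, hsol, hmom, ⟨E, hE⟩, ha, hb⟩ := hC
  obtain ⟨Λ⟩ := (GeneralizedLimit.nonempty_holds : Nonempty GeneralizedLimit)
  -- per-`j` facts
  have hLH : ∀ j, FluidPDE.Torus.IsGlobalLerayHopf (ν j) (fun _ => fun x => Φ x • G x) (u j 0) (u j) :=
    fun j => (hsol j).1.isGlobalLerayHopf
  have hsup : ∀ j, ∀ t : ℝ, 0 ≤ t → kineticEnergy (u j t) ≤ 2⁻¹ * E := fun j t _ => by
    unfold kineticEnergy
    exact mul_le_mul_of_nonneg_left (hE j t) (by norm_num)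
  have hsup' : ∀ j, ∃ C : ℝ, ∀ t : ℝ, 0 ≤ t → kineticEnergy (u j t) ≤ C := fun j => ⟨_, hsup j⟩
  have hEnn : 0 ≤ E := le_trans (integral_nonneg fun x => sq_nonneg _) (hE 0 0)
  -- the `O(ν)` term: `|∫⟪u, Δ(Ψ•G)⟫| ≤ K₀` uniformly in `j` and `t ≥ 0`
  have hV : IsSmooth (fun y => Ψ y • G y) := hΨ.smul' hG
  obtain ⟨K, hK0, hK⟩ :=
    FluidPDE.Torus.exists_nonneg_forall_norm_le_of_continuous hV.laplacian.continuous
  set K₀ : ℝ := K * (2⁻¹ * (1 + 2 * (2⁻¹ * E))) with hK₀def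
  have hK₀ : 0 ≤ K₀ := by positivity
  have hLt : ∀ j (t : ℝ), 0 ≤ t →
      |∫ x, ⟪u j t x, Torus.laplacian (fun y => Ψ y • G y) x⟫| ≤ K₀ := fun j t ht =>
    impulseGrid_abs_integral_inner_le (hLH j) hK0 hK (hsup j) ht
  -- choose the tail: `ν j · (K₀ + 1) < η / 2` for `j ≥ J`
  have hε : 0 < η / (2 * (K₀ + 1)) := by positivity
  obtain ⟨J, hJ⟩ := eventually_atTop.1 (hν0.eventually (gt_mem_nhds hε))
  have hsmall : ∀ j, J ≤ j → ν j * K₀ ≤ η / 2 := by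
    intro j hj
    have h1 : ν j < η / (2 * (K₀ + 1)) := hJ j hj
    have h2 : ν j * K₀ ≤ ν j * (K₀ + 1) := mul_le_mul_of_nonneg_left (by linarith) (hν j).le
    have h3 : ν j * (K₀ + 1) < η / (2 * (K₀ + 1)) * (K₀ + 1) := mul_lt_mul_of_pos_right h1 (by linarith)
    have h4 : η / (2 * (K₀ + 1)) * (K₀ + 1) = η / 2 := by field_simp
    linarith
  refine ⟨Φ, Ψ, G, c, η / 2, Λ, hΦ, hΨ, hG, hΨinv, hGinv, hG0, hGdiv, hΨ', hnorm, hf1, hf2, hf3, hc,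
    half_pos hη, fun j => ν (j + J), fun j => u (j + J) 0, fun j => u (j + J), fun j => hν _,
    hν0.comp (tendsto_add_atTop_nat J), fun j => hLH _, fun j => hsup' _, fun j => hmom _,
    ⟨E, fun j => ?_⟩, fun j => ?_, fun j => ?_, fun j => ?_⟩
  · -- mean energy
    obtain ⟨hcl, hτ, hper⟩ := hsol (j + J)
    rw [meanEnergy_eq_longTimeAvgSup,
      longTimeAvgSup_eq_of_periodic (periodic_comp hper fun v => ∫ x, ‖v x‖ ^ 2) hτ]
    have hbound : ‖∫ t in (0 : ℝ)..τ (j + J), ∫ x, ‖u (j + J) t x‖ ^ 2‖ ≤ E * |τ (j + J) - 0| := by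
      refine intervalIntegral.norm_integral_le_of_norm_le_const fun t _ => ?_
      rw [Real.norm_of_nonneg (integral_nonneg fun x => sq_nonneg _)]
      exact hE (j + J) t
    rw [sub_zero, abs_of_pos hτ] at hbound
    calc (τ (j + J))⁻¹ * ∫ t in (0 : ℝ)..τ (j + J), ∫ x, ‖u (j + J) t x‖ ^ 2
        ≤ (τ (j + J))⁻¹ * (E * τ (j + J)) :=
          mul_le_mul_of_nonneg_left ((le_abs_self _).trans hbound) (inv_nonneg.2 hτ.le)
      _ = E := by field_simp
  · -- no leakage (equality along a periodic classical wake)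
    obtain ⟨hcl, hτ, hper⟩ := hsol (j + J)
    exact (work_eq_meanDissipation_aux hcl hper hτ).le
  · -- (a) no reversal
    obtain ⟨hcl, hτ, hper⟩ := hsol (j + J)
    rw [longTimeAvg_eq_periodMean Λ hper hτ fun v => ∫ x, ⟪G x, v x⟫]
    exact mul_nonneg (inv_nonneg.2 hτ.le) (ha (j + J))
  · -- (b) early relaxation with `η/2`
    set i := j + J with hidef
    obtain ⟨hcl, hτ, hper⟩ := hsol i
    have hI := (impulseGrid_gridInjectionIdentity Λ (ν i) c Φ Ψ G (u i 0) (u i) (hν i) hΦ hΨ hG hΨinv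
      hGinv hG0 hGdiv hΨ' (hLH i) (hsup' i)).1
    rw [hnorm] at hI
    have hA : Λ.longTimeAvg (fun t => ∫ x, ⟪G x, u i t x⟫) = (τ i)⁻¹ * ∫ t in (0 : ℝ)..τ i, ∫ x, ⟪G x, u i t x⟫ :=
      longTimeAvg_eq_periodMean Λ hper hτ fun v => ∫ x, ⟪G x, v x⟫
    have hF : Λ.longTimeAvg (fun t => ∫ x, ⟪Φ x • G x, u i t x⟫) =
        (τ i)⁻¹ * (ν i * ∫ t in (0 : ℝ)..τ i, gradNormSq (u i t)) := by
      rw [longTimeAvg_eq_periodMean Λ hper hτ fun v => ∫ x, ⟪Φ x • G x, v x⟫,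
        period_work_eq_dissipation hcl hper hτ]
    have hL : Λ.longTimeAvg (fun t => ∫ x, ⟪u i t x, Torus.laplacian (fun y => Ψ y • G y) x⟫) =
        (τ i)⁻¹ * ∫ t in (0 : ℝ)..τ i, ∫ x, ⟪u i t x, Torus.laplacian (fun y => Ψ y • G y) x⟫ :=
      longTimeAvg_eq_periodMean Λ hper hτ fun v => ∫ x, ⟪v x, Torus.laplacian (fun y => Ψ y • G y) x⟫
    -- detuned work `W = ν D − A`
    have hW := detunedWork_eq_aux hcl hΦ hG hper hτ
    set A := ∫ t in (0 : ℝ)..τ i, ∫ x, ⟪G x, u i t x⟫ with hAdef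
    set D := ∫ t in (0 : ℝ)..τ i, gradNormSq (u i t) with hDdef
    set L := ∫ t in (0 : ℝ)..τ i, ∫ x, ⟪u i t x, Torus.laplacian (fun y => Ψ y • G y) x⟫ with hLdef
    set W := ∫ t in (0 : ℝ)..τ i, ∫ x, (Φ x - 1) * ⟪G x, u i t x⟫ with hWdef
    have hbi : τ i * η ≤ c * W := hb i
    -- `|L| ≤ τ K₀`
    have hLb : |L| ≤ K₀ * τ i := by
      have h := intervalIntegral.norm_integral_le_of_norm_le_const (a := (0 : ℝ)) (b := τ i) (C := K₀)
        (f := fun t => ∫ x, ⟪u i t x, Torus.laplacian (fun y => Ψ y • G y) x⟫) fun t ht => by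
          rw [Real.norm_eq_abs]
          rw [uIoc_of_le hτ.le] at ht
          exact hLt i t ht.1.le
      rw [sub_zero, abs_of_pos hτ, Real.norm_eq_abs] at h
      exact h
    have hτinv : 0 < (τ i)⁻¹ := inv_pos.2 hτ
    have key : Λ.longTimeAvg (fun t => ∫ x, ⟪u i t x - c • EuclideanSpace.single 0 1,
        Torus.convect (fun y => u i t y - c • EuclideanSpace.single 0 1) (fun y => Ψ y • G y) x⟫) =
        -((τ i)⁻¹ * (c * W + ν i * L)) := by
      rw [hA, hF, hL] at hI
      rw [hW]
      linear_combination hI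
    rw [key]
    -- `−τ⁻¹ (c W + ν L) ≤ −η + ν K₀ ≤ −η/2`
    have h1 : (τ i)⁻¹ * (c * W) ≥ η := by
      calc η = (τ i)⁻¹ * (τ i * η) := by field_simp
        _ ≤ (τ i)⁻¹ * (c * W) := mul_le_mul_of_nonneg_left hbi hτinv.le
    have h2 : |(τ i)⁻¹ * (ν i * L)| ≤ ν i * K₀ := by
      rw [abs_mul, abs_mul, abs_of_pos hτinv, abs_of_pos (hν i)]
      calc (τ i)⁻¹ * (ν i * |L|) ≤ (τ i)⁻¹ * (ν i * (K₀ * τ i)) :=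
            mul_le_mul_of_nonneg_left (mul_le_mul_of_nonneg_left hLb (hν i).le) hτinv.le
        _ = ν i * K₀ := by field_simp
    have h3 : ν i * K₀ ≤ η / 2 := hsmall i (Nat.le_add_left J j)
    have h4 := neg_abs_le ((τ i)⁻¹ * (ν i * L))
    rw [mul_add]
    linarith

end Transfer

end Summit.AnomalousDissipation.AnomalousDissipation.Theorems.ImpulseGridGridSigns

end
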